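import Summits.MatrixMultiplication.MatrixMultiplication.Theorems.FarEdgeDescentHolderShadow
import Summits.MatrixMultiplication.MatrixMultiplication.Theorems.FarEdgeDescentExitSlope
import Literature.NumberTheory.LFunctions.VinogradovKorobovInputsProofs
import HarnessLib

/-!
# Route `FarEdgeDescent` — Kernel XXII-C «the two corners: the cone dial and the tangent invariants»

decomp-mm ROOT cell (D-0178), lens 2 «structural dichotomy: special vs generic», gen 46; Theses-free
(imports XXII-A/B and through them XXI-A…D and `Literature` only; every field `K`; item texts INLINE).
Cut of record UNCHANGED.  Notation: `θ = specMMPoint K φ`, darkness `d(φ) = θ₁+θ₂+θ₃−2`, depth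
`ε(φ) = 1−θ₂`, `e(x) = ω_K(1,x,1) − (x+1)`, `τ = ω_K − 2`, `σ_K` = minimal top depth (XXII-B).

§1 THE CONE DIAL (every field, every real `M > 0`):
   `ω_K = 2 ⟺ E(M) ∧ W(M)` (`omega_eq_two_iff_coneDial`), where the CONE LEVEL `E(M) : ω_K(1,M+1,1) = M+2`
   says the whole shadow lies in the cone `d ≤ M·ε` (`saturated_iff_farCone`) and the WEDGE LIGHTNESS
   `W(M) : ∀φ, d(φ) ≤ M·ε(φ) → d(φ) = 0` says the wedge below slope `M` holds no dark point.  Both pieces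
   are consequences of `ω_K = 2`; `E` is monotone and `W` antitone in `M` (`coneLevel_mono`,
   `wedgeLight_anti`); the endpoints are the route's special crux and the summit:
   `(∃ M>0, E(M)) ⟺ FS_K-shape` (`exists_coneLevel_iff_fsShape`) and `(∀ M>0, W(M)) ⟺ ω_K = 2`
   (`forall_wedgeLight_iff`).  A one-parameter family of special/generic cuts of the summit on the true
   object, interpolating between «cone» (special, the ATTACKED side) and «no shallow dark point» (generic);
   its PIVOT is `τ/σ_K`: `E(M) ⟹ τ ≤ M·σ_K` and, when `ω_K > 2`, `W(M) ⟹ M·σ_K < τ` (`dial_sides`).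
§2 THE LIGHT CORNER (every field): `¬FS_K-shape ⟺` for every `M` some universal point is STEEP,
   `d > M·ε` (`not_fsShape_iff_steep`): failure of finite saturation is a CUSP of the shadow at its light
   corner `(ε,d) = (0,0)` — steep points are pinned there, `ε < e(x)/(M+1−x)` and `d ≤ M·e(x)/(M+1−x)` for
   `1 ≤ x < M+1` (`steep_near_lightCorner`; with `e(k) ≤ 9/(2 log(k+2))` both tend to `0`).  Under the
   generic item `ALC_K` with `ω_K > 2` the cusp is forced (`steep_of_alc`).  So the light-corner slope
   `Λ_K = sup d/ε ∈ {0} ∪ (0,∞) ∪ {∞}` trichotomises the worlds: `S ⟺ Λ_K = 0`, `FS ⟺ Λ_K < ∞`, and the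
   route's `closes` reads `ALC_K ⟹ Λ_K ∈ {0, ∞}`.
§3 THE TOP CORNER CONTROLS THE EXPONENT (every field, unconditional): for EVERY top point `φ`
   (`Σθ = ω_K`), `ω_K − 2 ≤ √ε(φ) + 9/log(1/ε(φ))` (`omega_sub_two_le_pinch`, the log-pinch of XXII-A at the
   top; Lean's junk values make the light case `ε = 0` exact) and `(ω_K − 2 − 9/(2log(k+2)))/(k−1) ≤ ε(φ)`
   for every `k ≥ 2` (`topDepth_ge`); with the ATTAINED `σ_K` (XXII-B): `u(τ) ≤ σ_K` and `τ ≤ H(σ_K)`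
   (`tangentInvariants`) — the two tangent invariants of the pencil at the square vanish TOGETHER, and
   `S ⟺ τ = 0 ⟺ σ_K = 0 ⟺ Λ_K = 0`.
§4 BLUNTNESS (under `ALC_K`, `ω_K > 2`): `e(x) ≥ τ − (x−1)σ + (x−1)²σ²/(2τ) − (x−1)³σ³/(6τ²)` for every top
   depth `σ` (`excess_ge_bluntParabola`, the exponential floor of XXI-C to third order via the tree's
   `cubic_le_exp_neg`); since `τ − (x−1)σ_K` IS the tangent (XXII-B), the generic item makes the
   excess uniformly convex at the square with curvature `≥ σ_K²/τ`, whereas a finitely carried germ is flat.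

NO definitions (gate rule D-0009).  Nothing here proves `ω = 2`.
References: [cite: Strassen1988, Thm. 3.8]; [cite: AlmanLi2026, Proposition 4.1, Proposition 4.2];
[cite: LottiRomani1983, Prop. 4.1]; [cite: Zuiddam2018, Thm. 2.15]; [cite: Coppersmith1997, Thm. 1].
-/

set_option linter.dupNamespace false

noncomputable section

open scoped BigOperators

namespace Summit.MatrixMultiplication.MatrixMultiplication.Theorems.FarEdgeDescentConeDial

open Literature.Computability.AlgebraicComplexity
open Summit.MatrixMultiplication.MatrixMultiplication.Theorems.FarEdgeDescentSpectralShadow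
open Summit.MatrixMultiplication.MatrixMultiplication.Theorems.FarEdgeDescentSpectralHorn
open Summit.MatrixMultiplication.MatrixMultiplication.Theorems.FarEdgeDescentFieldNode
open Summit.MatrixMultiplication.MatrixMultiplication.Theorems.FarEdgeDescentSpectralAbundance
open Summit.MatrixMultiplication.MatrixMultiplication.Theorems.FarEdgeDescentHolderShadow
open Summit.MatrixMultiplication.MatrixMultiplication.Theorems.FarEdgeDescentExitSlope

variable {K : Type} [Field K]

/-! ## §1 The cone dial -/

/-- **Cone levels are monotone**: `E(M) ⟹ E(M')` for `0 ≤ M ≤ M'` (the excess is antitone and `≥ 0`).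
[cite: LottiRomani1983, Prop. 4.1] -/
theorem coneLevel_mono {M M' : ℝ} (hMM' : M ≤ M') (hE : omegaRect K 1 (M + 1) 1 = M + 2) :
    omegaRect K 1 (M' + 1) 1 = M' + 2 := by
  refine le_antisymm ?_ (by have := add_one_le_omegaRect_one_mid_one K (M' + 1); linarith)
  have h := omegaRect_one_mid_one_sub_antitone K (by linarith : M + 1 ≤ M' + 1)
  simp only at h
  linarith

/-- **Wedge lightness is antitone**: `W(M') ⟹ W(M)` for `M ≤ M'` (a smaller wedge is contained in a
larger one; depths are `≥ 0`). [cite: AlmanLi2026, Proposition 4.1] -/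
theorem wedgeLight_anti {M M' : ℝ} (hMM' : M ≤ M')
    (hW : ∀ F : SpectralMap K, IsUniversalSpectralPoint K F →
      (∑ i, specMMPoint K F i) - 2 ≤ M' * (1 - specMMPoint K F 1) → ∑ i, specMMPoint K F i = 2) :
    ∀ F : SpectralMap K, IsUniversalSpectralPoint K F →
      (∑ i, specMMPoint K F i) - 2 ≤ M * (1 - specMMPoint K F 1) → ∑ i, specMMPoint K F i = 2 :=
  fun F hF h => hW F hF (le_trans h (mul_le_mul_of_nonneg_right hMM'
    (by linarith [(AlmanLi2026.prop42_mem_Icc hF 1).2])))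

/-- **The cone dial** (every field, every real `M > 0`): `ω_K = 2 ⟺ E(M) ∧ W(M)` — the shadow lies in
the cone `d ≤ M·ε` (`⟺ ω_K(1,M+1,1) = M+2`) AND the wedge `d ≤ M·ε` holds no dark point.  Each piece is a
consequence of `ω_K = 2`; together they empty the shadow of dark points. [cite: Strassen1988, Thm. 3.8]
[cite: AlmanLi2026, Proposition 4.2] -/
theorem omega_eq_two_iff_coneDial {M : ℝ} (hM : 0 < M) :
    omega K = 2 ↔
      omegaRect K 1 (M + 1) 1 = M + 2 ∧
        ∀ F : SpectralMap K, IsUniversalSpectralPoint K F →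
          (∑ i, specMMPoint K F i) - 2 ≤ M * (1 - specMMPoint K F 1) → ∑ i, specMMPoint K F i = 2 := by
  constructor
  · intro h2
    refine ⟨by have := excess_eq_zero_of_omega_eq_two h2 (by linarith : (1 : ℝ) ≤ M + 1); linarith,
      fun F hF _ => ?_⟩
    exact le_antisymm (omega_eq_two_iff_noDark.1 h2 F hF) (AlmanLi2026.prop42_two_le_sum hF)
  · rintro ⟨hE, hW⟩
    have hcone := (saturated_iff_farCone (K := K) (by linarith : (0 : ℝ) ≤ M + 1)).1 (by rw [hE]; ring)
    refine omega_eq_two_iff_noDark.2 fun F hF => ?_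
    have h := hcone F hF
    rw [add_sub_cancel_right] at h
    rw [hW F hF h]

/-- **Special endpoint of the dial**: `(∃ M > 0, E(M)) ⟺` the text of `FiniteSaturation` over `K`.
[cite: LottiRomani1983, Prop. 4.1] -/
theorem exists_coneLevel_iff_fsShape :
    (∃ M : ℝ, 0 < M ∧ omegaRect K 1 (M + 1) 1 = M + 2) ↔
      ∃ k : ℕ, 2 ≤ k ∧ omegaRect K 1 k 1 = k + 1 := by
  constructor
  · rintro ⟨M, hM, hE⟩
    have hc : 1 ≤ ⌈M⌉₊ := Nat.one_le_iff_ne_zero.2 (Nat.pos_iff_ne_zero.1 (Nat.ceil_pos.2 hM))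
    refine ⟨⌈M⌉₊ + 1, by omega, ?_⟩
    have h := coneLevel_mono (Nat.le_ceil M) hE
    push_cast
    linarith
  · rintro ⟨k, hk, hE⟩
    have hk' : (2 : ℝ) ≤ k := by exact_mod_cast hk
    refine ⟨(k : ℝ) - 1, by linarith, ?_⟩
    rw [sub_add_cancel, hE]
    ring

/-- **Generic endpoint of the dial**: `(∀ M > 0, W(M)) ⟺ ω_K = 2` (a dark point with `ε > 0` lies in
the wedge of slope `d/ε + 1`; points with `ε = 0` are light, `light_of_coord_eq_one`).
[cite: LottiRomani1983, Prop. 4.1] [cite: AlmanLi2026, Proposition 4.2] -/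
theorem forall_wedgeLight_iff :
    (∀ M : ℝ, 0 < M → ∀ F : SpectralMap K, IsUniversalSpectralPoint K F →
        (∑ i, specMMPoint K F i) - 2 ≤ M * (1 - specMMPoint K F 1) → ∑ i, specMMPoint K F i = 2) ↔
      omega K = 2 := by
  constructor
  · intro h
    refine omega_eq_two_iff_noDark.2 fun F hF => ?_
    have hd := AlmanLi2026.prop42_two_le_sum hF
    rcases eq_or_lt_of_le (AlmanLi2026.prop42_mem_Icc hF 1).2 with h1 | h1
    · rw [light_of_coord_eq_one hF 1 h1]
    · have hε : 0 < 1 - specMMPoint K F 1 := by linarith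
      have hM : 0 < ((∑ i, specMMPoint K F i) - 2) / (1 - specMMPoint K F 1) + 1 := by
        have := div_nonneg (by linarith : 0 ≤ (∑ i, specMMPoint K F i) - 2) hε.le
        linarith
      have h' := h _ hM F hF (by rw [add_mul, div_mul_cancel₀ _ hε.ne', one_mul]; linarith)
      rw [h']
  · intro h2 M _ F hF _
    exact le_antisymm (omega_eq_two_iff_noDark.1 h2 F hF) (AlmanLi2026.prop42_two_le_sum hF)

/-- **The pivot of the dial** (every field): a cone level `E(M)` puts every TOP point in the wedge,
`ω_K − 2 ≤ M·ε(φ)`; so `E(M)` needs `M ≥ τ/ε(φ)` for every top `φ`, i.e. `M ≥ τ/σ_K`.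
[cite: Strassen1988, Thm. 3.8] -/
theorem omega_sub_two_le_of_coneLevel {M : ℝ} (hM : 0 ≤ M) (hE : omegaRect K 1 (M + 1) 1 = M + 2)
    {F : SpectralMap K} (hF : IsUniversalSpectralPoint K F) (htop : ∑ i, specMMPoint K F i = omega K) :
    omega K - 2 ≤ M * (1 - specMMPoint K F 1) := by
  have h := (saturated_iff_farCone (K := K) (by linarith : (0 : ℝ) ≤ M + 1)).1 (by rw [hE]; ring) F hF
  rwa [add_sub_cancel_right, htop] at h

/-- **The pivot of the dial, generic side**: a wedge lightness `W(M)` containing a top point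
(`ω_K − 2 ≤ M·ε(φ)`, e.g. `M ≥ τ/σ_K`) already gives `ω_K = 2`; so in a dark world `W(M)` lives only
below the pivot `τ/σ_K` and `E(M)` only above it. [cite: AlmanLi2026, Proposition 4.2] -/
theorem omega_eq_two_of_wedgeLight_top {M : ℝ}
    (hW : ∀ F : SpectralMap K, IsUniversalSpectralPoint K F →
      (∑ i, specMMPoint K F i) - 2 ≤ M * (1 - specMMPoint K F 1) → ∑ i, specMMPoint K F i = 2)
    {F : SpectralMap K} (hF : IsUniversalSpectralPoint K F) (htop : ∑ i, specMMPoint K F i = omega K)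
    (hin : omega K - 2 ≤ M * (1 - specMMPoint K F 1)) : omega K = 2 := by
  rw [← htop] at hin ⊢
  exact hW F hF hin

/-- **The two sides of the pivot** (every field, `ω_K > 2`): for every top point `φ` and every `M`,
`E(M) ⟹ τ ≤ M·ε(φ)` and `W(M) ⟹ M·ε(φ) < τ` — the special and the generic piece of the dial are never
simultaneously available at one level, as they must not be. [cite: Strassen1988, Thm. 3.8]
[cite: AlmanLi2026, Proposition 4.2] -/
theorem dial_sides (hω : 2 < omega K) {F : SpectralMap K} (hF : IsUniversalSpectralPoint K F)
    (htop : ∑ i, specMMPoint K F i = omega K) {M : ℝ} (hM : 0 ≤ M) :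
    (omegaRect K 1 (M + 1) 1 = M + 2 → omega K - 2 ≤ M * (1 - specMMPoint K F 1)) ∧
      ((∀ G : SpectralMap K, IsUniversalSpectralPoint K G →
          (∑ i, specMMPoint K G i) - 2 ≤ M * (1 - specMMPoint K G 1) → ∑ i, specMMPoint K G i = 2) →
        M * (1 - specMMPoint K F 1) < omega K - 2) :=
  ⟨fun hE => omega_sub_two_le_of_coneLevel hM hE hF htop, fun hW => not_le.1 fun hin =>
    absurd (omega_eq_two_of_wedgeLight_top hW hF htop hin) (ne_of_gt hω)⟩

/-! ## §2 The light corner: cusp versus wedge -/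

/-- **`¬FS_K ⟺` steep points at every slope**: the text of `FiniteSaturation` over `K` fails iff for
every real `M` some universal point has `d > M·ε` (such a point is dark). [cite: Strassen1988, Thm. 3.8]
[cite: LottiRomani1983, Prop. 4.1] -/
theorem not_fsShape_iff_steep :
    (¬ ∃ k : ℕ, 2 ≤ k ∧ omegaRect K 1 k 1 = k + 1) ↔
      ∀ M : ℝ, ∃ F : SpectralMap K, IsUniversalSpectralPoint K F ∧
        M * (1 - specMMPoint K F 1) < (∑ i, specMMPoint K F i) - 2 := by
  rw [finiteSaturationShape_iff_cone]
  constructor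
  · intro h M
    by_contra hc
    push Not at hc
    refine h ⟨⌈M⌉₊ + 2, by omega, fun F hF => le_trans (hc F hF) ?_⟩
    push_cast
    exact mul_le_mul_of_nonneg_right (by linarith [Nat.le_ceil M])
      (by linarith [(AlmanLi2026.prop42_mem_Icc hF 1).2])
  · rintro h ⟨k, -, hcone⟩
    obtain ⟨F, hF, hlt⟩ := h ((k : ℝ) - 1)
    exact absurd (hcone F hF) (not_le.2 hlt)

/-- **Steep points sit at the light corner**: if `d(φ) > M·ε(φ)` then, for every real `x ∈ [1, M+1)`,
`ε(φ) < e(x)/(M+1−x)` and `d(φ) ≤ M·e(x)/(M+1−x)` (the horn `d ≤ (x−1)ε + e(x)`).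
[cite: Strassen1988, Thm. 3.8] [cite: LottiRomani1983, Prop. 4.1] -/
theorem steep_near_lightCorner {F : SpectralMap K} (hF : IsUniversalSpectralPoint K F) {M x : ℝ}
    (hx : 1 ≤ x) (hxM : x < M + 1)
    (hsteep : M * (1 - specMMPoint K F 1) < (∑ i, specMMPoint K F i) - 2) :
    1 - specMMPoint K F 1 < (omegaRect K 1 x 1 - (x + 1)) / (M + 1 - x) ∧
      (∑ i, specMMPoint K F i) - 2 ≤ M * ((omegaRect K 1 x 1 - (x + 1)) / (M + 1 - x)) := by
  have hfar := darkness_le_far hF (by linarith : (0 : ℝ) ≤ x)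
  have hgap : 0 < M + 1 - x := by linarith
  have hε : 1 - specMMPoint K F 1 < (omegaRect K 1 x 1 - (x + 1)) / (M + 1 - x) := by
    rw [lt_div_iff₀ hgap]
    nlinarith
  refine ⟨hε, ?_⟩
  have h1 : (x - 1) * (1 - specMMPoint K F 1) ≤ (x - 1) * ((omegaRect K 1 x 1 - (x + 1)) / (M + 1 - x)) :=
    mul_le_mul_of_nonneg_left hε.le (by linarith)
  have h2 : (x - 1) * ((omegaRect K 1 x 1 - (x + 1)) / (M + 1 - x)) + (omegaRect K 1 x 1 - (x + 1)) =
      M * ((omegaRect K 1 x 1 - (x + 1)) / (M + 1 - x)) := by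
    field_simp
    ring
  linarith

/-- **The generic item forces the cusp** (every field): under the text of `AnchoredLogConvexity` over
`K` and `ω_K > 2`, for every `M` some universal point is steep, `d > M·ε` — `FS_K` fails (the node
`ω_K = 2 ⟺ FS_K ∧ ALC_K`, XXI-C), so the light corner of the shadow is a cusp.
[cite: Strassen1988, Thm. 3.8] [cite: LottiRomani1983, Prop. 4.1] -/
theorem steep_of_alc
    (hA : ∀ m : ℝ, 1 < m →
      (omegaRect K 1 m 1 - (m + 1)) ^ 2 ≤ (omegaRect K 1 1 1 - 2) * (omegaRect K 1 (2 * m - 1) 1 - 2 * m))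
    (hω : 2 < omega K) (M : ℝ) :
    ∃ F : SpectralMap K, IsUniversalSpectralPoint K F ∧
      M * (1 - specMMPoint K F 1) < (∑ i, specMMPoint K F i) - 2 :=
  not_fsShape_iff_steep.1 (fun hFS => absurd (omega_eq_two_iff_node.2 ⟨hFS, hA⟩) (ne_of_gt hω)) M

/-! ## §3 The top corner controls the exponent -/

/-- **Depth of a top point is bounded below by the darkness**: for every top point `φ` and every
`k ≥ 2`, `(ω_K − 2 − 9/(2 log(k+2)))/(k−1) ≤ ε(φ)` (the horn at format `k` and Lotti–Romani's rate).
[cite: LottiRomani1983, Prop. 4.1] [cite: Strassen1988, Thm. 3.8] -/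
theorem topDepth_ge {F : SpectralMap K} (hF : IsUniversalSpectralPoint K F)
    (htop : ∑ i, specMMPoint K F i = omega K) {k : ℕ} (hk : 2 ≤ k) :
    (omega K - 2 - 9 / (2 * Real.log ((k : ℝ) + 2))) / ((k : ℝ) - 1) ≤ 1 - specMMPoint K F 1 := by
  have hk' : (2 : ℝ) ≤ k := by exact_mod_cast hk
  have hfar := darkness_le_far hF (by linarith : (0 : ℝ) ≤ k)
  have hlog := excess_le_log (K := K) k
  rw [div_le_iff₀ (by linarith : (0 : ℝ) < (k : ℝ) - 1), htop] at *
  linarith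

/-- **The exponent is controlled by the depth of ANY top point** (every field, unconditional):
`ω_K − 2 ≤ √ε(φ) + 9/log(1/ε(φ))` whenever `Σθ(φ) = ω_K` (the unconditional log-pinch of XXII-A read at
the top; in the light case `ε = 0` both sides vanish — `9/log(1/0) = 0` in Lean — and for `ε = 1` the
bound is `ω_K − 2 ≤ 1`).  With the shallowest top point: `τ ≤ √σ_K + 9/log(1/σ_K)`.
[cite: LottiRomani1983, Prop. 4.1] [cite: AlmanLi2026, Proposition 4.1, Proposition 4.2] -/
theorem omega_sub_two_le_pinch {F : SpectralMap K} (hF : IsUniversalSpectralPoint K F)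
    (htop : ∑ i, specMMPoint K F i = omega K) :
    omega K - 2 ≤ Real.sqrt (1 - specMMPoint K F 1) + 9 / Real.log (1 / (1 - specMMPoint K F 1)) := by
  have hθ := AlmanLi2026.prop42_mem_Icc hF
  rcases eq_or_lt_of_le (hθ 1).2 with h1 | h1
  · -- on the face: light, `ω_K = 2`
    have h2 := light_of_coord_eq_one hF 1 h1
    rw [h1, sub_self, Real.sqrt_zero, div_zero, Real.log_zero, div_zero, add_zero, ← htop, h2, sub_self]
  rcases eq_or_lt_of_le (hθ 1).1 with h0 | h0
  · -- `θ₂ = 0`: the bound reads `ω_K − 2 ≤ 1`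
    rw [← h0, sub_zero, Real.sqrt_one, div_one, Real.log_one, div_zero, add_zero, ← htop, sum_three]
    linarith [(hθ 0).2, (hθ 2).2]
  · have h := darkness_le_logPinch hF (by linarith) (by linarith)
    rwa [htop] at h

/-- **The tangent invariants vanish together** (every field, unconditional): with the attained minimal
top depth `σ_K` (XXII-B `exists_top_shallowest`), `0 ≤ σ_K ≤ 1`,
`(ω_K − 2 − 9/(2log(k+2)))/(k−1) ≤ σ_K` for every `k ≥ 2`, and `ω_K − 2 ≤ √σ_K + 9/log(1/σ_K)`; hence
`ω_K = 2 ⟺ σ_K = 0`, quantitatively in both directions. [cite: Zuiddam2018, Thm. 2.15]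
[cite: LottiRomani1983, Prop. 4.1] [cite: AlmanLi2026, Proposition 4.2] -/
theorem tangentInvariants :
    ∃ σ : ℝ, 0 ≤ σ ∧ σ ≤ 1 ∧
      (∃ F : SpectralMap K, IsUniversalSpectralPoint K F ∧ ∑ i, specMMPoint K F i = omega K ∧
        specMMPoint K F 1 = 1 - σ) ∧
      (∀ G : SpectralMap K, IsUniversalSpectralPoint K G → ∑ i, specMMPoint K G i = omega K →
        σ ≤ 1 - specMMPoint K G 1) ∧
      (∀ k : ℕ, 2 ≤ k → (omega K - 2 - 9 / (2 * Real.log ((k : ℝ) + 2))) / ((k : ℝ) - 1) ≤ σ) ∧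
      omega K - 2 ≤ Real.sqrt σ + 9 / Real.log (1 / σ) ∧
      (omega K = 2 ↔ σ = 0) := by
  obtain ⟨F, hF, htop, hmax⟩ := exists_top_shallowest (K := K)
  have hθ := AlmanLi2026.prop42_mem_Icc hF 1
  refine ⟨1 - specMMPoint K F 1, by linarith [hθ.2], by linarith [hθ.1], ⟨F, hF, htop, by ring⟩,
    fun G hG htopG => by linarith [hmax G hG htopG], fun k hk => topDepth_ge hF htop hk,
    omega_sub_two_le_pinch hF htop, ?_⟩
  rw [omega_eq_two_iff_top_on_face]
  constructor
  · rintro ⟨G, hG, htopG, h1⟩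
    have := hmax G hG htopG
    linarith [hθ.2]
  · intro h0
    exact ⟨F, hF, htop, by linarith⟩

/-! ## §4 Bluntness: the second-order content of the exponential floor -/

/-- **Bluntness at the square** (under `ALC_K`, `ω_K > 2`; every top point `φ`, depth `σ = ε(φ)`):
`e(x) ≥ τ − (x−1)σ + (x−1)²σ²/(2τ) − (x−1)³σ³/(6τ²)` for all real `x ≥ 1`.  For the shallowest top point
the linear part `τ − (x−1)σ_K` is EXACTLY the tangent of `e` at `1⁺` (XXII-B), so this bounds the
second-order remainder from below: curvature `≥ σ_K²/τ` at the square — the generic item makes the top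
corner of the shadow uniformly blunt. [cite: Strassen1988, Thm. 3.8] [cite: LottiRomani1983, Prop. 4.1] -/
theorem excess_ge_bluntParabola
    (hA : ∀ m : ℝ, 1 < m →
      (omegaRect K 1 m 1 - (m + 1)) ^ 2 ≤ (omegaRect K 1 1 1 - 2) * (omegaRect K 1 (2 * m - 1) 1 - 2 * m))
    (hω : 2 < omega K) {F : SpectralMap K} (hF : IsUniversalSpectralPoint K F)
    (htop : ∑ i, specMMPoint K F i = omega K) {x : ℝ} (hx : 1 ≤ x) :
    (omega K - 2) - (x - 1) * (1 - specMMPoint K F 1) +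
        (x - 1) ^ 2 * (1 - specMMPoint K F 1) ^ 2 / (2 * (omega K - 2)) -
        (x - 1) ^ 3 * (1 - specMMPoint K F 1) ^ 3 / (6 * (omega K - 2) ^ 2) ≤
      omegaRect K 1 x 1 - (x + 1) := by
  have hτ : 0 < omega K - 2 := by linarith
  have hσ : 0 ≤ 1 - specMMPoint K F 1 := by linarith [(AlmanLi2026.prop42_mem_Icc hF 1).2]
  set u : ℝ := (x - 1) * (1 - specMMPoint K F 1) / (omega K - 2) with hu
  have hu0 : 0 ≤ u := div_nonneg (mul_nonneg (by linarith) hσ) hτ.le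
  have hfloor := excess_ge_exp_floor hA hω hF htop hx
  have hcub := mul_le_mul_of_nonneg_left
    (Literature.NumberTheory.LFunctions.ZetaRealLeRamare.cubic_le_exp_neg hu0) hτ.le
  have e : (omega K - 2) * (1 - u + u ^ 2 / 2 - u ^ 3 / 6) =
      (omega K - 2) - (x - 1) * (1 - specMMPoint K F 1) +
        (x - 1) ^ 2 * (1 - specMMPoint K F 1) ^ 2 / (2 * (omega K - 2)) -
        (x - 1) ^ 3 * (1 - specMMPoint K F 1) ^ 3 / (6 * (omega K - 2) ^ 2) := by
    rw [hu]
    field_simp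
  linarith

end Summit.MatrixMultiplication.MatrixMultiplication.Theorems.FarEdgeDescentConeDial

end
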